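import Summits.QuantumFields.YangMills.Theorems.BalabanUVNodesN07ChartD3Cubic
import Summits.QuantumFields.YangMills.Theorems.BalabanUVNodesN07ChartLogAnalytic
import HarnessLib

/-!
# BalabanUVNodes ∕ N07 — [15] (56) AT ORDER TWO, `D^{(2)} = C^{(2)}`, AND «THE LINEAR TERM … COMING FROM THE DIFFERENTIATION OF D^{(2)}(A′) = C^{(2)}(A′)» (p. 289) AT NODE 00's
# RECORD — the second differential of the TRUE multi-level chart `D(·)` of (47)–(49) IS the second differential of the charted constraint `chartLog η D`, both symmetric

Cell `pub-ymgap`, width seat `pub-ymgap-dag-n07-w2` generation 6 (HUMAN RULING D-0149; DAG node N07 = [15] = [Balaban1985Variational]; W-SEAT START LIST §n07 item 2 = S2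
«[15] Sect. C (47)–(49), Prop. 3 at objects» — the first recursive equation of (56) and the clause of the closing remark of Sect. C that generation 5 left by definition).
`--kind proof --supports stmt-QuantumFields-27364 --as helper` (K1⁹ face per KEY MAP v2; count-neutral).  CONSUMED BY NAME, nothing modified: this seat's
`N07ChartD3Cubic.exists_chartD3_T4` (generation 5: ONE `(H, Dfun)` at the record with (46), `C^ω`, holomorphic `fderiv`, `fderiv ℂ Dfun 0 = 0`, per-point (55)∕(49)∕(48)∕(73),
the 𝔇^{(1)}∕𝔇₂ bounds, `D^{(2)}(A′) := ½D²Dfun(0)(A′,A′)` sized `4C₂σ²` and `D₃ := D − D^{(2)}` cubic `8C₂σ³∕ε`), `N07ChartLogAnalytic.analyticOnNhd_chartLog_weightedBall_of_adm22`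
(generation 3: the charted constraint is analytic on the weighted `R⋆`-ball), dag k0-s1-w2's `K0Stub1ChartDAnalytic.isOpen_weightedBall`; Mathlib's `HasFDerivAt.clm_comp`,
`HasFDerivAt.unique`, `ContDiffAt.isSymmSndFDerivAt`, `ContinuousLinearMap.hasFDerivAt_of_bilinear`, `AnalyticAt.fderiv`, `LinearMap.toContinuousLinearMap`.

THE PRINT (p. 286 [PDF 10] and p. 289 [PDF 13], text layer `paper:balaban1985-cmp102-variational-background` pp. 10, 13, 14 re-read by this seat).  p. 286: «|D(A′)| = |C_j(LʲηA′
− LʲηHD(A′))| ≦ C₂(Lʲη|A′| + B₀|D(A′)|)² ≦ 4C₂|A′|²₍₋₁₎. (55) This implies that a power series expansion of D(A′) begins with second order terms. We can find this expression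
from Eq. (49) and the expansion (136) [4] of the function C_j: C_j(LʲηA′ − LʲηHD(A′)) = Σ_{n=2}^∞ C_j^{(n)}(LʲηA′ − LʲηH Σ_{m=2}^∞ D^{(m)}(A′)) = Σ_{n=2}^∞ D^{(n)}(A′), (56) where
C_j^{(n)}, D^{(n)} are homogeneous polynomials of nth order. From Eq. (56) a sequence of recursive equations for D^{(n)} follows. It can be solved easily. For example we have on
Λ_j D^{(2)}(A′) = C_j^{(2)}(LʲηA′), D^{(3)}(A′) = C_j^{(3)}(LʲηA′) − 2C_j^{(2)}(LʲηA′, LʲηHC^{(2)}(A′)), and so on. Here C_j^{(2)}(A′, A″) denotes a symmetric bilinear form obtained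
by polarization from the quadratic form C_j^{(2)}(A), and C^{(2)}(A′) = C_j^{(2)}(LʲηA′) on Λ_j.»  p. 289, after Proposition 3: «The operator 𝔇(A′) is an analytic function in A′,
and its expansion begins with a linear term in A′, coming from the differentiation of D^{(2)}(A′) = C^{(2)}(A′).»  p. 290: «Taking into account that the second order term
D^{(2)}(A′) in the expansion of D(A′) is equal to C^{(2)}(A′) = C_j^{(2)}(LʲηA′) on Λ_j, we have ⟨HD(A′), J⟩ = ⟨HC^{(2)}(A′), J⟩ + ⟨HD₃(A′), J⟩. (78)».

THE READING (tree vocabulary; scales absorbed in `chartLog η D`, the tree's `C`; `Qlin = D chartLog(0)`, the tree's `Q`; (48) `chartLog η D (A′ − H·Dfun A′) = Qlin A′`,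
`Qlin ∘ H = 1`).  The second-order part of an analytic map at `0` is `½D²(·)(0)(A′, A′)`; (56)'s first recursive equation «D^{(2)}(A′) = C^{(2)}(A′)» is the statement
**`D²Dfun(0) = D²chartLog(0)`** (as continuous bilinear maps), obtained by differentiating (48) twice at the base point: with `G(A′) = A′ − H·Dfun(A′)` (`G(0) = 0`,
`DG(0) = 1` since `𝔇(0) = DDfun(0) = 0`), `D[chartLog ∘ G] = (D chartLog)(G A′) ∘ (1 − H∘𝔇(A′))` is the constant `Qlin` near `0`, so its derivative at `0`,
`D²chartLog(0)(B, ·) − Qlin∘H∘D²Dfun(0)(B, ·) = D²chartLog(0)(B, ·) − D²Dfun(0)(B, ·)`, vanishes — the cancellation `Qlin∘H = 1` is exactly the order-two step of the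
recursion.  «symmetric bilinear form obtained by polarization» = the symmetry of the second derivative of an analytic map (`ContDiffAt.isSymmSndFDerivAt`, `ℂ` is `RCLike`);
«the linear term … coming from the differentiation of D^{(2)}(A′)» = `δ[½D²Dfun(0)(A,A)]∕δA |_{A′} = D²Dfun(0)(A′, ·)`, which IS the linear term `𝔇^{(1)}(A′) = (D𝔇)(0)A′`
subtracted in `N07ChartD2Remainder` (there by definition) — and equals `δC^{(2)}∕δA′ = 2C^{(2)}(A′, ·)` in print's polarization notation.

WHAT IS PROVED (sorry-free; no definition; axioms standard).
§1 (abstract) ★★★ `fderiv_fderiv_eq_of_implicit` — any nontrivially normed field `𝕜`, normed `𝕜`-spaces `X, Y`, `Φ C : X → Y`, `Q : X →L Y`, `H : Y →L X` with `Q∘H = 1`, (48)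
   `C(A − HΦ(A)) = QA` near `0`, `Φ 0 = 0`, `DΦ(0) = 0`, `DC(0) = Q`, `Φ`∕`C` differentiable near `0` with `DΦ`∕`DC` differentiable at `0` ⇒ **`D²Φ(0) = D²C(0)`** (NO remainder constants,
   NO analyticity: the twice-differentiable core of (56) at order two); ★★ `hasFDerivAt_half_bilin_self` — a symmetric continuous bilinear `B` over an `RCLike` field has
   `HasFDerivAt (A ↦ ½·B A A) (B A′) A′` (the derivative of a quadratic form is its polarization at the point).
§2 ★★★★ `exists_chartD2_eq_C2_T4` — for every `F : T4Family`: `N07ChartD3Cubic.exists_chartD3_T4` RE-EXPORTED VERBATIM (thresholds, constants, binders, the SAME `(H, Dfun)` and all its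
   conjuncts) ∧, writing `Q₂ := fderiv ℂ (fderiv ℂ (chartLog η D)) 0` (`= 2C^{(2)}(·, ·)`): **(56₁) `fderiv ℂ (fderiv ℂ Dfun) 0 = Q₂`** ∧ **symmetry** of `D²Dfun(0)` and of `Q₂` ∧
   **(56₂) `½·D²Dfun(0)(A′)(A′) = ½·Q₂(A′)(A′)`** for every `A′` («D^{(2)}(A′) = C^{(2)}(A′)») ∧ **`HasFDerivAt (A ↦ ½·D²Dfun(0)(A)(A)) (D²Dfun(0)(A′)) A′`** and the same for
   `A ↦ ½·Q₂(A)(A)` («the linear term … coming from the differentiation of D^{(2)}(A′) = C^{(2)}(A′)»: `𝔇^{(1)}(A′) = δD^{(2)}∕δA′ = δC^{(2)}∕δA′`) ∧ at every point of the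
   ball `HasFDerivAt (A ↦ Dfun A − ½·Q₂(A)(A)) (fderiv ℂ Dfun A′ − Q₂ A′) A′` ((85)'s `δD₃(A′)∕δA′` IS print's `𝔇₂(A′)`, `D₃ = D − C^{(2)}`) ∧ the two sizes RE-KEYED ON
   `C^{(2)}`: **`‖(½·Q₂(A′)(A′))(j,c)‖ ≤ 4C₂σ²`** (`σ > 0`) and **`‖(Dfun A′ − ½·Q₂(A′)(A′))(j,c)‖ ≤ 8C₂σ³∕ε`** (`0 < σ < ε`) for `A′` of weighted size `≤ σ` — (78)'s split
   `D = C^{(2)} + D₃` with `D₃` cubic, at the record: lit-balaban's `B11Ineq73KernelLettersPerLattice` convention `HD₃ = HD − HC⁽²⁾` and `N07ChartD3Cubic`'s `D − D^{(2)}` AGREE ∧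
   the p. 289 remark with PRINT's subtracted term `Q₂(A′) = δC^{(2)}∕δA′`: the norm-level and kernel-entry bounds of `Q₂(A′)` (`4C₃σ`) and of `𝔇₂(A′) := fderiv ℂ Dfun A′ − Q₂(A′)`
   (`8C₃σ²∕ε`, «(73) with ε₃² instead of ε₃»), `N07ChartD2Remainder.exists_chartD2_T4`'s four bounds re-keyed by (56₁).

HONEST FRAMING: count-neutral helper; second-derivative chain rule ∕ uniqueness of derivatives ∕ symmetry of second derivatives (Mathlib calculus) on this seat's record package —
NO new estimate of [15]; (56) BEYOND ORDER TWO (the printed `D^{(3)}`, the full recursion, (56) as a convergent series — lit-balaban p06's `B11Eq56SeriesConcrete` ∕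
`B11Eq56Order3Concrete` are the concrete one-scale models), (58), the ∇-row of (46)∕(73), (79)–(80), (85)–(86) and [15] Sects. D–F NOT here; stub 1 ∕ K0⁷ ∕ K1⁹ NOT closed; N07
NOT discharged; counts unmoved; one finite T⁴ programme at fixed ε — NOT continuum ∕ ℝ⁴ ∕ OS ∕ mass gap ∕ Clay: the Yang–Mills mass gap is NOT proved by any of this; R4 closes
the conditional rung `BalabanLadder.UV` only.  No `sorry`, no `def`, no `instance`, no `notation`.

References: [15] T. Bałaban, CMP 102 (1985) 277–309 [Balaban1985Variational] ((47)–(49) p.285, (55)–(56) p.286, Prop. 3 + remark p.289, (78) p.290, (85) p.291); [4] = [B7] CMP 98 (1985)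
17–51 [Balaban1985Averaging] ((136) p.39).
-/

noncomputable section

open scoped BigOperators Matrix.Norms.L2Operator ContDiff Topology
open NormedSpace Metric Set Filter Asymptotics

namespace Summit.QuantumFields.YangMills.BalabanUVNodes.N07ChartD2EqC2

open Literature.MathematicalPhysics.QuantumFieldTheory.Balaban1983to89
open Literature.MathematicalPhysics.QuantumFieldTheory.Balaban1983to89.T4Continuum (T4Family)
open B6SectADomainsV1 (Domains)
open B6SectAOperatorsV1 (BondIdx)
open Summit.QuantumFields.YangMills.Theorems.FlatCubeOpsText (Adm22 distBI)
open Summit.QuantumFields.YangMills.Theorems.K0FlatCubeOpsTextP (IsLevWeight levWeight_nonneg)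
open Summit.QuantumFields.YangMills.Theorems.Prop8Chart (chartLog)
open Summit.QuantumFields.YangMills.Theorems.K0Stub1ChartDAnalytic (isOpen_weightedBall)
open Summit.QuantumFields.YangMills.BalabanUVNodes.N07ChartLogAnalytic (analyticOnNhd_chartLog_weightedBall_of_adm22)
open Summit.QuantumFields.YangMills.BalabanUVNodes.N07ChartD3Cubic (exists_chartD3_T4)

/-! ## §1 The second differentiation of (48) at the base point, and the derivative of a quadratic form (abstract) -/

section Implicit

variable {𝕜 : Type*} [NontriviallyNormedField 𝕜] {X Y : Type*} [NormedAddCommGroup X] [NormedSpace 𝕜 X]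
  [NormedAddCommGroup Y] [NormedSpace 𝕜 Y]

/-- ★★★ **(56) AT ORDER TWO, THE TWICE-DIFFERENTIABLE CORE: `D²Φ(0) = D²C(0)`.**  Let `Q∘H = 1`, let (48) `C(A − HΦ(A)) = QA` hold near `0`, `Φ 0 = 0`, `DΦ(0) = 0` ((55): the
expansion of `D` begins at order two), `DC(0) = Q`, and let `Φ`, `C` be differentiable near `0` with `DΦ`, `DC` differentiable at `0`.  Then the second differentials agree:
**`fderiv (fderiv Φ) 0 = fderiv (fderiv C) 0`** — print's «D^{(2)}(A′) = C_j^{(2)}(LʲηA′)», the first of the recursive equations read off (56).  Proof: `G(A) = A − HΦ(A)` has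
`G 0 = 0`, `DG(0) = 1`; near `0`, `D[C∘G](A) = DC(G A) ∘ (1 − H∘DΦ(A))` (chain rule) and also `= Q` ((48)); differentiating this operator identity at `0` by the product rule for
compositions (`HasFDerivAt.clm_comp`) and uniqueness of derivatives: `D²C(0)(B, ·)∘1 + Q∘(−H∘D²Φ(0)(B, ·)) = 0`, and `Q∘H = 1`. [cite: Balaban1985Variational, (48) p.285, (55)-(56) p.286, remark p.289] -/
theorem fderiv_fderiv_eq_of_implicit {Φ C : X → Y} {Q : X →L[𝕜] Y} {H : Y →L[𝕜] X}
    (hQH : ∀ y, Q (H y) = y)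
    (h48 : ∀ᶠ A in 𝓝 (0 : X), C (A - H (Φ A)) = Q A)
    (hΦ0 : Φ 0 = 0) (hDΦ0 : fderiv 𝕜 Φ 0 = 0)
    (hΦd : ∀ᶠ A in 𝓝 (0 : X), DifferentiableAt 𝕜 Φ A) (hΦ2 : DifferentiableAt 𝕜 (fderiv 𝕜 Φ) 0)
    (hCQ : fderiv 𝕜 C 0 = Q)
    (hCd : ∀ᶠ y in 𝓝 (0 : X), DifferentiableAt 𝕜 C y) (hC2 : DifferentiableAt 𝕜 (fderiv 𝕜 C) 0) :
    fderiv 𝕜 (fderiv 𝕜 Φ) 0 = fderiv 𝕜 (fderiv 𝕜 C) 0 := by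
  -- the argument map `G A = A − HΦ(A)`: `G 0 = 0`, `DG(0) = 1`, `G → 0`
  set G : X → X := fun A => A - H (Φ A) with hG
  have hG0 : G 0 = 0 := by simp [hG, hΦ0]
  have hΦd0 : HasFDerivAt Φ (0 : X →L[𝕜] Y) 0 := by
    have h := (hΦd.self_of_nhds : DifferentiableAt 𝕜 Φ 0).hasFDerivAt
    rwa [hDΦ0] at h
  have hGd : HasFDerivAt G (ContinuousLinearMap.id 𝕜 X) 0 := by
    have h2 := (hasFDerivAt_id (𝕜 := 𝕜) (0 : X)).sub (H.hasFDerivAt.comp (0 : X) hΦd0)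
    rw [ContinuousLinearMap.comp_zero, sub_zero] at h2
    exact h2
  have hGt : Tendsto G (𝓝 0) (𝓝 0) := by
    have h := hGd.continuousAt.tendsto
    rwa [hG0] at h
  -- near `0`: the chain rule for `C ∘ G`
  set M : X → (X →L[𝕜] Y) := fun A => (fderiv 𝕜 C (G A)).comp (ContinuousLinearMap.id 𝕜 X - H.comp (fderiv 𝕜 Φ A)) with hM
  have hev : ∀ᶠ A in 𝓝 (0 : X), HasFDerivAt (fun A => C (G A)) (M A) A := by
    filter_upwards [hΦd, hGt.eventually hCd] with A hA hCA
    have hGA : HasFDerivAt G (ContinuousLinearMap.id 𝕜 X - H.comp (fderiv 𝕜 Φ A)) A :=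
      (hasFDerivAt_id A).sub (H.hasFDerivAt.comp A hA.hasFDerivAt)
    exact hCA.hasFDerivAt.comp A hGA
  -- near `0`: `C ∘ G = Q` ((48)), so `M = Q` there, and `DM(0) = 0`
  have hMQ : M =ᶠ[𝓝 0] fun _ => Q := by
    have h1 : ∀ᶠ A in 𝓝 (0 : X), ∀ᶠ B in 𝓝 A, C (B - H (Φ B)) = Q B := h48.eventually_nhds
    filter_upwards [hev, h1] with A hA hA'
    have hQ : HasFDerivAt (fun B => C (G B)) Q A := Q.hasFDerivAt.congr_of_eventuallyEq (hA'.mono fun B hB => hB)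
    exact hA.unique hQ
  have hMd0 : HasFDerivAt M (0 : X →L[𝕜] X →L[𝕜] Y) 0 := (hasFDerivAt_const Q (0 : X)).congr_of_eventuallyEq hMQ
  -- the derivative of `M` at `0` by the product rule for compositions
  have hc : HasFDerivAt (fun A => fderiv 𝕜 C (G A)) ((fderiv 𝕜 (fderiv 𝕜 C) 0).comp (ContinuousLinearMap.id 𝕜 X)) 0 := by
    have h' : HasFDerivAt (fderiv 𝕜 C) (fderiv 𝕜 (fderiv 𝕜 C) 0) (G 0) := by rw [hG0]; exact hC2.hasFDerivAt
    exact h'.comp (0 : X) hGd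
  have hd : HasFDerivAt (fun A => ContinuousLinearMap.id 𝕜 X - H.comp (fderiv 𝕜 Φ A))
      (0 - ((ContinuousLinearMap.compL 𝕜 X Y X) H).comp (fderiv 𝕜 (fderiv 𝕜 Φ) 0)) 0 := by
    have h1 : HasFDerivAt (fun A => H.comp (fderiv 𝕜 Φ A)) (((ContinuousLinearMap.compL 𝕜 X Y X) H).comp (fderiv 𝕜 (fderiv 𝕜 Φ) 0)) 0 :=
      ((ContinuousLinearMap.compL 𝕜 X Y X) H).hasFDerivAt.comp (0 : X) hΦ2.hasFDerivAt
    exact (hasFDerivAt_const _ _).sub h1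
  have huniq := (hc.clm_comp hd).unique hMd0
  -- evaluate the operator identity at `B`, `v`
  ext B v
  have h := congrArg (fun T : X →L[𝕜] X →L[𝕜] Y => T B v) huniq
  simp only [add_apply, ContinuousLinearMap.comp_apply, ContinuousLinearMap.compL_apply,
    ContinuousLinearMap.flip_apply, zero_apply,
    ContinuousLinearMap.coe_id', id_eq, hG0, hDΦ0, hCQ,
    ContinuousLinearMap.comp_zero, sub_zero, zero_sub, neg_apply, map_neg, hQH] at h
  rwa [neg_add_eq_sub, sub_eq_zero, eq_comm] at h

end Implicit

section Quadratic

variable {𝕜 : Type*} [RCLike 𝕜] {X Y : Type*} [NormedAddCommGroup X] [NormedSpace 𝕜 X]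
  [NormedAddCommGroup Y] [NormedSpace 𝕜 Y]

/-- ★★ **THE DERIVATIVE OF A QUADRATIC FORM IS ITS POLARIZATION AT THE POINT**: for a SYMMETRIC continuous bilinear `B` over an `RCLike` field,
`HasFDerivAt (A ↦ ½·B A A) (B A′) A′` — how «the linear term in A′» of `𝔇 = δD∕δA′` is «coming from the differentiation of D^{(2)}(A′)» (p. 289), with print's
«symmetric bilinear form obtained by polarization» (p. 286). [cite: Balaban1985Variational, (56) p.286, remark p.289] -/
theorem hasFDerivAt_half_bilin_self (B : X →L[𝕜] X →L[𝕜] Y) (hsym : ∀ u v, B u v = B v u) (A : X) :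
    HasFDerivAt (fun x => (2 : 𝕜)⁻¹ • B x x) (B A) A := by
  have h := (ContinuousLinearMap.hasFDerivAt_of_bilinear (B := B) (hasFDerivAt_id A) (hasFDerivAt_id A)).const_smul (2 : 𝕜)⁻¹
  refine h.congr_fderiv ?_
  ext v
  simp only [smul_apply, add_apply, ContinuousLinearMap.precompR_apply,
    ContinuousLinearMap.precompL_apply, ContinuousLinearMap.compL_apply, ContinuousLinearMap.comp_id,
    ContinuousLinearMap.coe_id', id_eq, hsym v A]
  rw [← two_smul 𝕜 (B A v), smul_smul, inv_mul_cancel₀ (two_ne_zero), one_smul]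

end Quadratic

/-! ## §2 At NODE 00's record: `D²Dfun(0) = D²chartLog(0)`, symmetric, `𝔇^{(1)} = δD^{(2)}∕δA′`, and (78)'s split re-keyed on `C^{(2)}` -/

/-- ★★★★ **[15] (56) AT ORDER TWO — «D^{(2)}(A′) = C^{(2)}(A′)» — AND THE p. 289 CLAUSE «coming from the differentiation of D^{(2)}(A′) = C^{(2)}(A′)», FOR THE TRUE
MULTI-LEVEL CHART AT NODE 00's RECORD.**  `N07ChartD3Cubic.exists_chartD3_T4` RE-EXPORTED VERBATIM — for every `F : T4Family`: thresholds `M_h⁰, R₀`, constants `C_K ≥ 0`,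
`δ₀ > 0`, `B₃ > 0`; for every admissible nested family `D` of top level `K − n` on NODE 00's torus, every level-weight family `w`, every `ε > 0` in the window: the SAME `(H, Dfun)`
with the (46) letter, `C^ω`, holomorphic `fderiv`, `fderiv ℂ Dfun 0 = 0`, per-point (55)∕(49)∕(48)∕`HasFDerivAt`∕(73) (norm + kernel), the 𝔇^{(1)} and 𝔇₂ bounds, `|D^{(2)}| ≤ 4C₂σ²`,
`|D − D^{(2)}| ≤ 8C₂σ³∕ε` — AND IN ADDITION, with `Q₂ := fderiv ℂ (fderiv ℂ (chartLog η D)) 0` (the second differential of the charted constraint at the base point, `Q₂(A)(B) =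
2C^{(2)}(A, B)`): **(56₁) `fderiv ℂ (fderiv ℂ Dfun) 0 = Q₂`**; **`D²Dfun(0)(A)(B) = D²Dfun(0)(B)(A)`** and **`Q₂(A)(B) = Q₂(B)(A)`** («symmetric bilinear form obtained by
polarization»); **(56₂) `½·D²Dfun(0)(A′)(A′) = ½·Q₂(A′)(A′)`** for every `A′` («D^{(2)}(A′) = C^{(2)}(A′)»); **`HasFDerivAt (A ↦ ½·D²Dfun(0)(A)(A)) (D²Dfun(0)(A′)) A′`** and
**`HasFDerivAt (A ↦ ½·Q₂(A)(A)) (D²Dfun(0)(A′)) A′`** — the linear term `𝔇^{(1)}(A′) = (fderiv ℂ (fderiv ℂ Dfun) 0) A′` subtracted in `N07ChartD2Remainder.exists_chartD2_T4` IS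
`δD^{(2)}∕δA′ = δC^{(2)}∕δA′`; at every point of the ball **`HasFDerivAt (A ↦ Dfun A − ½·Q₂(A)(A)) (fderiv ℂ Dfun A′ − Q₂ A′) A′`** — «δD₃(A′)∕δA′» of (85) IS `𝔇₂(A′)`
in print's definition; and for every `A′` of weighted size `≤ σ`: (`σ > 0`) **`‖(½·Q₂(A′)(A′))(j,c)‖ ≤ 4C₂σ²`**, (`0 < σ < ε`) **`‖(Dfun A′ − ½·Q₂(A′)(A′))(j,c)‖ ≤ 8C₂·σ³∕ε`**
— (78)'s «⟨HD(A′), J⟩ = ⟨HC^{(2)}(A′), J⟩ + ⟨HD₃(A′), J⟩» with `D₃ = D − C^{(2)}` CUBIC, at the record; and the p. 289 remark IN PRINT's OWN DEFINITION of the subtracted term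
(`𝔇^{(1)}(A′) := Q₂(A′) = δC^{(2)}∕δA′`, `𝔇₂(A′) := fderiv ℂ Dfun A′ − Q₂(A′)`): **`‖(Q₂(A′)W)(j,c)‖ ≤ 4C₃σ·t`**, its kernel-entry decay `4C₃σ·e^{2δ}·w₁(b)‖a‖·e^{−δ·distBI}`,
**`‖((fderiv ℂ Dfun A′ − Q₂ A′)W)(j,c)‖ ≤ 8C₃(σ²∕ε)·t`** and **`‖((fderiv ℂ Dfun A′ − Q₂ A′)(δ_b·a))(j,c)‖ ≤ 8C₃e^{2δ}(σ²∕ε)·w₁(b)‖a‖·e^{−δ·distBI D b (j,c)}`** («the bound (73)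
with ε₃² instead of ε₃»), `N07ChartD2Remainder`'s four bounds re-keyed by (56₁).  Proof: §1 on the record package (`chartLog` analytic at `0` by
`N07ChartLogAnalytic.analyticOnNhd_chartLog_weightedBall_of_adm22` at `R⋆`, `H` continuous by finite dimension), Mathlib's symmetry of second derivatives of `C^ω` maps.
[cite: Balaban1985Variational, (47)-(49) p.285, (55)-(56) p.286, Prop. 3 + remark p.289, (78) p.290; Balaban1985Averaging, (136) p.39] -/
theorem exists_chartD2_eq_C2_T4 {ι : Type*} [Fintype ι] [DecidableEq ι] [Nonempty ι] (F : T4Family) :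
    ∃ (Mh₀ R₀ : ℕ) (CK δ₀ B₃ : ℝ), 0 ≤ CK ∧ 0 < δ₀ ∧ 0 < B₃ ∧
    ∀ (n K : ℕ) (_ : 1 ≤ K - n) (_ : K - n + 1 ≤ F.m + K) {Mh R a' : ℕ} (_ : Mh = F.L ^ a') (_ : Mh₀ ≤ Mh) (_ : R₀ ≤ R) (_ : 2 * F.L ≤ R)
      (_ : a' + 3 ≤ F.m + n) (D : Domains (F.P K)) (_ : D.k = K - n) (_ : Adm22 D R (F.L * Mh))
      (w : ℕ → PBond (F.P K) 0 → ℝ) (_ : IsLevWeight (F.P K) (K - n) D w) {ε : ℝ} (_ : 0 < ε)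
      (_ : 18 * (960 * ((((F.P K).d + 2) * (F.P K).L : ℕ) : ℝ) * ((F.P K).L : ℝ) / (12800 * ((((F.P K).d + 2) * (F.P K).L : ℕ) : ℝ) ^ 2 * ((F.P K).L : ℝ))⁻¹) *
        (CK * B₃ * (1 + 2 * (((F.P K).d + 2) * (F.P K).L : ℕ)) * (1 + 2 * (((F.P K).d + 2) * (F.P K).L : ℕ) * (1 + (F.P K).L))) * ε ≤ 1)
      (_ : 64 * ε ≤ (12800 * ((((F.P K).d + 2) * (F.P K).L : ℕ) : ℝ) ^ 2 * ((F.P K).L : ℝ))⁻¹),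
      let η : ℝ := (((F.P K).L : ℝ)⁻¹) ^ (K - n)
      let Rs : ℝ := (12800 * ((((F.P K).d + 2) * (F.P K).L : ℕ) : ℝ) ^ 2 * ((F.P K).L : ℝ))⁻¹
      let C₂ : ℝ := 960 * ((((F.P K).d + 2) * (F.P K).L : ℕ) : ℝ) * ((F.P K).L : ℝ) / Rs
      let C₃ : ℝ := 3840 * ((((F.P K).d + 2) * (F.P K).L : ℕ) : ℝ) * ((F.P K).L : ℝ) / Rs
      let Qlin := (fderiv ℂ (chartLog η D : (PBond (F.P K) 0 → Matrix ι ι ℂ) → BondIdx D → Matrix ι ι ℂ) 0)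
      let Q₂ := (fderiv ℂ (fderiv ℂ (chartLog η D : (PBond (F.P K) 0 → Matrix ι ι ℂ) → BondIdx D → Matrix ι ι ℂ)) 0)
      ∃ (H : (BondIdx D → Matrix ι ι ℂ) →ₗ[ℂ] (PBond (F.P K) 0 → Matrix ι ι ℂ)) (Dfun : (PBond (F.P K) 0 → Matrix ι ι ℂ) → (BondIdx D → Matrix ι ι ℂ)),
        (∀ X, Qlin (H X) = X) ∧
        (∀ (X : BondIdx D → Matrix ι ι ℂ) (t : ℝ), 0 ≤ t → (∀ i, ‖X i‖ ≤ t) → ∀ b,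
          w 1 b * ‖H X b‖ ≤ CK * B₃ * (1 + 2 * (((F.P K).d + 2) * (F.P K).L : ℕ)) * (1 + 2 * (((F.P K).d + 2) * (F.P K).L : ℕ) * (1 + (F.P K).L)) * t) ∧
        ContDiffOn ℂ ω Dfun {A' : PBond (F.P K) 0 → Matrix ι ι ℂ | ∀ b, w 1 b * ‖A' b‖ < ε} ∧
        DifferentiableOn ℂ (fderiv ℂ Dfun) {A' : PBond (F.P K) 0 → Matrix ι ι ℂ | ∀ b, w 1 b * ‖A' b‖ < ε} ∧
        fderiv ℂ Dfun 0 = 0 ∧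
        (∀ A' : PBond (F.P K) 0 → Matrix ι ι ℂ, (∀ b, w 1 b * ‖A' b‖ < ε) →
          (∀ (ρ : ℝ), 0 ≤ ρ → (∀ b, w 1 b * ‖A' b‖ ≤ ρ) → ∀ i, ‖Dfun A' i‖ ≤ 4 * C₂ * ρ ^ 2) ∧
          chartLog η D (A' - H (Dfun A')) - Qlin (A' - H (Dfun A')) = Dfun A' ∧
          chartLog η D (A' - H (Dfun A')) = Qlin A' ∧
          HasFDerivAt Dfun (fderiv ℂ Dfun A') A' ∧
          (∀ (W : PBond (F.P K) 0 → Matrix ι ι ℂ) (t : ℝ), 0 ≤ t → (∀ b, w 1 b * ‖W b‖ ≤ t) → ∀ i, ‖fderiv ℂ Dfun A' W i‖ ≤ 4 * C₃ * ε * t) ∧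
          ∀ (b : PBond (F.P K) 0) (a : Matrix ι ι ℂ) (δ : ℝ), 0 ≤ δ → δ ≤ δ₀ / 2 →
            4 * C₃ * Real.exp (δ * 3) *
                (CK * B₃ * (1 + 2 * (((F.P K).d + 2) * (F.P K).L : ℕ) * Real.exp (δ * 4)) *
                  (1 + 2 * (((F.P K).d + 2) * (F.P K).L : ℕ) * (1 + (F.P K).L) * Real.exp (δ * 1))) * ε ≤ 1 →
            ∀ i, ‖fderiv ℂ Dfun A' (Pi.single b a) i‖ ≤ 4 * C₃ * ε * Real.exp (δ * 2) * (w 1 b * ‖a‖) * Real.exp (-(δ * distBI D b i))) ∧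
        (∀ σ : ℝ, 0 < σ → ∀ A' : PBond (F.P K) 0 → Matrix ι ι ℂ, (∀ b, w 1 b * ‖A' b‖ ≤ σ) →
          ∀ (W : PBond (F.P K) 0 → Matrix ι ι ℂ) (t : ℝ), 0 ≤ t → (∀ b, w 1 b * ‖W b‖ ≤ t) → ∀ i,
            ‖(fderiv ℂ (fderiv ℂ Dfun) 0 A') W i‖ ≤ 4 * C₃ * σ * t) ∧
        (∀ σ : ℝ, 0 < σ → ∀ A' : PBond (F.P K) 0 → Matrix ι ι ℂ, (∀ b, w 1 b * ‖A' b‖ ≤ σ) →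
          ∀ (b : PBond (F.P K) 0) (a : Matrix ι ι ℂ) (δ : ℝ), 0 ≤ δ → δ ≤ δ₀ / 2 →
            4 * C₃ * Real.exp (δ * 3) *
                (CK * B₃ * (1 + 2 * (((F.P K).d + 2) * (F.P K).L : ℕ) * Real.exp (δ * 4)) *
                  (1 + 2 * (((F.P K).d + 2) * (F.P K).L : ℕ) * (1 + (F.P K).L) * Real.exp (δ * 1))) * ε ≤ 1 →
            ∀ i, ‖(fderiv ℂ (fderiv ℂ Dfun) 0 A') (Pi.single b a) i‖ ≤
              4 * C₃ * σ * Real.exp (δ * 2) * (w 1 b * ‖a‖) * Real.exp (-(δ * distBI D b i))) ∧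
        (∀ σ : ℝ, 0 < σ → σ < ε → ∀ A' : PBond (F.P K) 0 → Matrix ι ι ℂ, (∀ b, w 1 b * ‖A' b‖ ≤ σ) →
          ∀ (W : PBond (F.P K) 0 → Matrix ι ι ℂ) (t : ℝ), 0 ≤ t → (∀ b, w 1 b * ‖W b‖ ≤ t) → ∀ i,
            ‖(fderiv ℂ Dfun A' - fderiv ℂ (fderiv ℂ Dfun) 0 A') W i‖ ≤ 8 * C₃ * (σ ^ 2 / ε) * t) ∧
        (∀ σ : ℝ, 0 < σ → σ < ε → ∀ A' : PBond (F.P K) 0 → Matrix ι ι ℂ, (∀ b, w 1 b * ‖A' b‖ ≤ σ) →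
          ∀ (b : PBond (F.P K) 0) (a : Matrix ι ι ℂ) (δ : ℝ), 0 ≤ δ → δ ≤ δ₀ / 2 →
            4 * C₃ * Real.exp (δ * 3) *
                (CK * B₃ * (1 + 2 * (((F.P K).d + 2) * (F.P K).L : ℕ) * Real.exp (δ * 4)) *
                  (1 + 2 * (((F.P K).d + 2) * (F.P K).L : ℕ) * (1 + (F.P K).L) * Real.exp (δ * 1))) * ε ≤ 1 →
            ∀ i, ‖(fderiv ℂ Dfun A' - fderiv ℂ (fderiv ℂ Dfun) 0 A') (Pi.single b a) i‖ ≤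
              8 * C₃ * Real.exp (δ * 2) * (σ ^ 2 / ε) * (w 1 b * ‖a‖) * Real.exp (-(δ * distBI D b i))) ∧
        (∀ σ : ℝ, 0 < σ → ∀ A' : PBond (F.P K) 0 → Matrix ι ι ℂ, (∀ b, w 1 b * ‖A' b‖ ≤ σ) → ∀ i,
            ‖(2 : ℂ)⁻¹ • ((fderiv ℂ (fderiv ℂ Dfun) 0 A') A') i‖ ≤ 4 * C₂ * σ ^ 2) ∧
        (∀ σ : ℝ, 0 < σ → σ < ε → ∀ A' : PBond (F.P K) 0 → Matrix ι ι ℂ, (∀ b, w 1 b * ‖A' b‖ ≤ σ) → ∀ i,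
            ‖Dfun A' i - (2 : ℂ)⁻¹ • ((fderiv ℂ (fderiv ℂ Dfun) 0 A') A') i‖ ≤ 8 * C₂ * (σ ^ 3 / ε)) ∧
        fderiv ℂ (fderiv ℂ Dfun) 0 = Q₂ ∧
        (∀ A B : PBond (F.P K) 0 → Matrix ι ι ℂ, (fderiv ℂ (fderiv ℂ Dfun) 0 A) B = (fderiv ℂ (fderiv ℂ Dfun) 0 B) A) ∧
        (∀ A B : PBond (F.P K) 0 → Matrix ι ι ℂ, (Q₂ A) B = (Q₂ B) A) ∧
        (∀ A' : PBond (F.P K) 0 → Matrix ι ι ℂ, (2 : ℂ)⁻¹ • (fderiv ℂ (fderiv ℂ Dfun) 0 A') A' = (2 : ℂ)⁻¹ • (Q₂ A') A') ∧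
        (∀ A' : PBond (F.P K) 0 → Matrix ι ι ℂ,
          HasFDerivAt (fun A : PBond (F.P K) 0 → Matrix ι ι ℂ => (2 : ℂ)⁻¹ • (fderiv ℂ (fderiv ℂ Dfun) 0 A) A) (fderiv ℂ (fderiv ℂ Dfun) 0 A') A') ∧
        (∀ A' : PBond (F.P K) 0 → Matrix ι ι ℂ,
          HasFDerivAt (fun A : PBond (F.P K) 0 → Matrix ι ι ℂ => (2 : ℂ)⁻¹ • (Q₂ A) A) (fderiv ℂ (fderiv ℂ Dfun) 0 A') A') ∧
        (∀ A' : PBond (F.P K) 0 → Matrix ι ι ℂ, (∀ b, w 1 b * ‖A' b‖ < ε) →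
          HasFDerivAt (fun A : PBond (F.P K) 0 → Matrix ι ι ℂ => Dfun A - (2 : ℂ)⁻¹ • (Q₂ A) A) (fderiv ℂ Dfun A' - Q₂ A') A') ∧
        (∀ σ : ℝ, 0 < σ → ∀ A' : PBond (F.P K) 0 → Matrix ι ι ℂ, (∀ b, w 1 b * ‖A' b‖ ≤ σ) → ∀ i,
            ‖(2 : ℂ)⁻¹ • ((Q₂ A') A') i‖ ≤ 4 * C₂ * σ ^ 2) ∧
        (∀ σ : ℝ, 0 < σ → σ < ε → ∀ A' : PBond (F.P K) 0 → Matrix ι ι ℂ, (∀ b, w 1 b * ‖A' b‖ ≤ σ) → ∀ i,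
            ‖Dfun A' i - (2 : ℂ)⁻¹ • ((Q₂ A') A') i‖ ≤ 8 * C₂ * (σ ^ 3 / ε)) ∧
        (∀ σ : ℝ, 0 < σ → ∀ A' : PBond (F.P K) 0 → Matrix ι ι ℂ, (∀ b, w 1 b * ‖A' b‖ ≤ σ) →
          ∀ (W : PBond (F.P K) 0 → Matrix ι ι ℂ) (t : ℝ), 0 ≤ t → (∀ b, w 1 b * ‖W b‖ ≤ t) → ∀ i,
            ‖(Q₂ A') W i‖ ≤ 4 * C₃ * σ * t) ∧
        (∀ σ : ℝ, 0 < σ → ∀ A' : PBond (F.P K) 0 → Matrix ι ι ℂ, (∀ b, w 1 b * ‖A' b‖ ≤ σ) →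
          ∀ (b : PBond (F.P K) 0) (a : Matrix ι ι ℂ) (δ : ℝ), 0 ≤ δ → δ ≤ δ₀ / 2 →
            4 * C₃ * Real.exp (δ * 3) *
                (CK * B₃ * (1 + 2 * (((F.P K).d + 2) * (F.P K).L : ℕ) * Real.exp (δ * 4)) *
                  (1 + 2 * (((F.P K).d + 2) * (F.P K).L : ℕ) * (1 + (F.P K).L) * Real.exp (δ * 1))) * ε ≤ 1 →
            ∀ i, ‖(Q₂ A') (Pi.single b a) i‖ ≤
              4 * C₃ * σ * Real.exp (δ * 2) * (w 1 b * ‖a‖) * Real.exp (-(δ * distBI D b i))) ∧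
        (∀ σ : ℝ, 0 < σ → σ < ε → ∀ A' : PBond (F.P K) 0 → Matrix ι ι ℂ, (∀ b, w 1 b * ‖A' b‖ ≤ σ) →
          ∀ (W : PBond (F.P K) 0 → Matrix ι ι ℂ) (t : ℝ), 0 ≤ t → (∀ b, w 1 b * ‖W b‖ ≤ t) → ∀ i,
            ‖(fderiv ℂ Dfun A' - Q₂ A') W i‖ ≤ 8 * C₃ * (σ ^ 2 / ε) * t) ∧
        (∀ σ : ℝ, 0 < σ → σ < ε → ∀ A' : PBond (F.P K) 0 → Matrix ι ι ℂ, (∀ b, w 1 b * ‖A' b‖ ≤ σ) →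
          ∀ (b : PBond (F.P K) 0) (a : Matrix ι ι ℂ) (δ : ℝ), 0 ≤ δ → δ ≤ δ₀ / 2 →
            4 * C₃ * Real.exp (δ * 3) *
                (CK * B₃ * (1 + 2 * (((F.P K).d + 2) * (F.P K).L : ℕ) * Real.exp (δ * 4)) *
                  (1 + 2 * (((F.P K).d + 2) * (F.P K).L : ℕ) * (1 + (F.P K).L) * Real.exp (δ * 1))) * ε ≤ 1 →
            ∀ i, ‖(fderiv ℂ Dfun A' - Q₂ A') (Pi.single b a) i‖ ≤
              8 * C₃ * Real.exp (δ * 2) * (σ ^ 2 / ε) * (w 1 b * ‖a‖) * Real.exp (-(δ * distBI D b i))) := by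
  classical
  obtain ⟨Mh₀, R₀, CK, δ₀, B₃, hCK, hδ₀, hB₃, hmain⟩ := exists_chartD3_T4 (ι := ι) F
  refine ⟨Mh₀, R₀, CK, δ₀, B₃, hCK, hδ₀, hB₃, ?_⟩
  intro n K hk1 hk' Mh R a' hMha hMh hR h2L hsize D hDk hAdm w hw ε hε h18 h2 η Rs C₂ C₃ Qlin Q₂
  obtain ⟨H, Dfun, hHinv, hsup, hω, hfd, h0, hpt, hlinN, hlinK, h2N, h2K, hD2, hD3⟩ :=
    hmain n K hk1 hk' hMha hMh hR h2L hsize D hDk hAdm w hw hε h18 h2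
  -- the open weighted ball, `0` in it
  have hU : IsOpen {A' : PBond (F.P K) 0 → Matrix ι ι ℂ | ∀ b, w 1 b * ‖A' b‖ < ε} := isOpen_weightedBall w ε
  have h0U : (0 : PBond (F.P K) 0 → Matrix ι ι ℂ) ∈ {A' : PBond (F.P K) 0 → Matrix ι ι ℂ | ∀ b, w 1 b * ‖A' b‖ < ε} := by
    intro b
    simpa using hε
  have hUn : {A' : PBond (F.P K) 0 → Matrix ι ι ℂ | ∀ b, w 1 b * ‖A' b‖ < ε} ∈ 𝓝 (0 : PBond (F.P K) 0 → Matrix ι ι ℂ) := hU.mem_nhds h0U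
  -- `Dfun 0 = 0` ((55) at `ρ = 0`)
  have hΦ0 : Dfun 0 = 0 := by
    funext i
    have h := (hpt 0 h0U).1 0 le_rfl (fun b => by simp) i
    rw [zero_pow two_ne_zero, mul_zero] at h
    exact norm_le_zero_iff.mp h
  -- `Dfun` differentiable near `0`, `fderiv ℂ Dfun` differentiable at `0`
  have hΦd : ∀ᶠ A in 𝓝 (0 : PBond (F.P K) 0 → Matrix ι ι ℂ), DifferentiableAt ℂ Dfun A := by
    filter_upwards [hUn] with A hA using (hpt A hA).2.2.2.1.differentiableAt
  have hΦ2 : DifferentiableAt ℂ (fderiv ℂ Dfun) 0 := hfd.differentiableAt hUn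
  -- the charted constraint is analytic at `0` (weighted `R⋆`-ball, collar from (2.2)-admissibility)
  have hL1 : 1 ≤ F.L := by have := F.hL11; omega
  have hM : 1 ≤ F.L * Mh := by
    rw [hMha]; exact Nat.one_le_iff_ne_zero.mpr (Nat.mul_ne_zero (by omega) (pow_ne_zero _ (by omega)))
  have hPL : (F.P K).L = F.L := rfl
  have hRM : 2 * (F.P K).L ≤ R * (F.L * Mh) + 1 := by
    have : R ≤ R * (F.L * Mh) := Nat.le_mul_of_pos_right R hM
    rw [hPL]; omega
  have hden : 0 < 12800 * ((((F.P K).d + 2) * (F.P K).L : ℕ) : ℝ) ^ 2 * ((F.P K).L : ℝ) := by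
    have hL0 : (0 : ℝ) < (F.P K).L := by exact_mod_cast (F.P K).L_pos
    have hℓ1 : (1 : ℝ) ≤ ((((F.P K).d + 2) * (F.P K).L : ℕ) : ℝ) := by
      exact_mod_cast Nat.one_le_iff_ne_zero.mpr (Nat.mul_ne_zero (by omega) (by have := (F.P K).hL.2; omega))
    positivity
  have hRs0 : 0 < Rs := inv_pos.mpr hden
  have hRs1 : 12800 * ((((F.P K).d + 2) * (F.P K).L : ℕ) : ℝ) ^ 2 * ((F.P K).L : ℝ) * Rs ≤ 1 := by
    show 12800 * ((((F.P K).d + 2) * (F.P K).L : ℕ) : ℝ) ^ 2 * ((F.P K).L : ℝ) *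
        (12800 * ((((F.P K).d + 2) * (F.P K).L : ℕ) : ℝ) ^ 2 * ((F.P K).L : ℝ))⁻¹ ≤ 1
    rw [mul_inv_cancel₀ hden.ne']
  have han := analyticOnNhd_chartLog_weightedBall_of_adm22 (𝔸 := Matrix ι ι ℂ) (K - n) D hDk hAdm hRM hw hRs1
  have h0Rs : (0 : PBond (F.P K) 0 → Matrix ι ι ℂ) ∈ {Y : PBond (F.P K) 0 → Matrix ι ι ℂ | ∀ b, w 1 b * ‖Y b‖ < Rs} := by
    intro b
    simpa using hRs0
  have hCan : AnalyticAt ℂ (chartLog η D : (PBond (F.P K) 0 → Matrix ι ι ℂ) → BondIdx D → Matrix ι ι ℂ) 0 := han 0 h0Rs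
  have hCd : ∀ᶠ y in 𝓝 (0 : PBond (F.P K) 0 → Matrix ι ι ℂ),
      DifferentiableAt ℂ (chartLog η D : (PBond (F.P K) 0 → Matrix ι ι ℂ) → BondIdx D → Matrix ι ι ℂ) y :=
    hCan.eventually_analyticAt.mono fun y hy => hy.differentiableAt
  have hC2 : DifferentiableAt ℂ (fderiv ℂ (chartLog η D : (PBond (F.P K) 0 → Matrix ι ι ℂ) → BondIdx D → Matrix ι ι ℂ)) 0 :=
    hCan.fderiv.differentiableAt
  -- `H` as a continuous linear map (finite dimension); `Qlin ∘ H = 1`; (48) near `0`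
  let Hc : (BondIdx D → Matrix ι ι ℂ) →L[ℂ] (PBond (F.P K) 0 → Matrix ι ι ℂ) := LinearMap.toContinuousLinearMap H
  have hHc : ∀ y, Hc y = H y := fun _ => rfl
  have hQH : ∀ y, Qlin (Hc y) = y := fun y => by rw [hHc]; exact hHinv y
  have h48 : ∀ᶠ A in 𝓝 (0 : PBond (F.P K) 0 → Matrix ι ι ℂ),
      (chartLog η D : (PBond (F.P K) 0 → Matrix ι ι ℂ) → BondIdx D → Matrix ι ι ℂ) (A - Hc (Dfun A)) = Qlin A := by
    filter_upwards [hUn] with A hA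
    rw [hHc]
    exact (hpt A hA).2.2.1
  -- (56₁): the second differentials agree
  have h56 : fderiv ℂ (fderiv ℂ Dfun) 0 = Q₂ :=
    fderiv_fderiv_eq_of_implicit hQH h48 hΦ0 h0 hΦd hΦ2 rfl hCd hC2
  -- symmetry (`C^ω` at `0`, `ℂ` is `RCLike`)
  have hsymD : ∀ A B : PBond (F.P K) 0 → Matrix ι ι ℂ, (fderiv ℂ (fderiv ℂ Dfun) 0 A) B = (fderiv ℂ (fderiv ℂ Dfun) 0 B) A :=
    fun A B => (hω.contDiffAt hUn).isSymmSndFDerivAt (by simp) A B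
  have hsymC : ∀ A B : PBond (F.P K) 0 → Matrix ι ι ℂ, (Q₂ A) B = (Q₂ B) A := fun A B => by
    rw [← h56]; exact hsymD A B
  -- the derivatives of the quadratic forms, and of `D₃ = D − C^{(2)}`
  have hder : ∀ A' : PBond (F.P K) 0 → Matrix ι ι ℂ,
      HasFDerivAt (fun A : PBond (F.P K) 0 → Matrix ι ι ℂ => (2 : ℂ)⁻¹ • (fderiv ℂ (fderiv ℂ Dfun) 0 A) A) (fderiv ℂ (fderiv ℂ Dfun) 0 A') A' :=
    fun A' => hasFDerivAt_half_bilin_self (fderiv ℂ (fderiv ℂ Dfun) 0) hsymD A'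
  have hderC : ∀ A' : PBond (F.P K) 0 → Matrix ι ι ℂ,
      HasFDerivAt (fun A : PBond (F.P K) 0 → Matrix ι ι ℂ => (2 : ℂ)⁻¹ • (Q₂ A) A) (Q₂ A') A' :=
    fun A' => hasFDerivAt_half_bilin_self Q₂ hsymC A'
  have hderD3 : ∀ A' : PBond (F.P K) 0 → Matrix ι ι ℂ, (∀ b, w 1 b * ‖A' b‖ < ε) →
      HasFDerivAt (fun A : PBond (F.P K) 0 → Matrix ι ι ℂ => Dfun A - (2 : ℂ)⁻¹ • (Q₂ A) A) (fderiv ℂ Dfun A' - Q₂ A') A' :=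
    fun A' hA' => (hpt A' hA').2.2.2.1.sub (hderC A')
  refine ⟨H, Dfun, hHinv, hsup, hω, hfd, h0, hpt, hlinN, hlinK, h2N, h2K, hD2, hD3, h56, hsymD, hsymC, fun A' => by rw [h56], hder,
    fun A' => by rw [h56]; exact hderC A', hderD3, ?_, ?_, ?_, ?_, ?_, ?_⟩
  · intro σ hσ A' hA' i
    rw [← h56]
    exact hD2 σ hσ A' hA' i
  · intro σ hσ hσε A' hA' i
    rw [← h56]
    exact hD3 σ hσ hσε A' hA' i
  · intro σ hσ A' hA' W t ht hW i
    rw [← h56]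
    exact hlinN σ hσ A' hA' W t ht hW i
  · intro σ hσ A' hA' b a δ hδ hδh hsmall i
    rw [← h56]
    exact hlinK σ hσ A' hA' b a δ hδ hδh hsmall i
  · intro σ hσ hσε A' hA' W t ht hW i
    rw [← h56]
    exact h2N σ hσ hσε A' hA' W t ht hW i
  · intro σ hσ hσε A' hA' b a δ hδ hδh hsmall i
    rw [← h56]
    exact h2K σ hσ hσε A' hA' b a δ hδ hδh hsmall i

end Summit.QuantumFields.YangMills.BalabanUVNodes.N07ChartD2EqC2

end
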